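import Mathlib
import HarnessLib
import Literature.Analysis.Calculus.PlanarPolarIntegral

/-!
# Double integrals over polar rectangles and disks are iterated integrals over a box in polar coordinates

Topic `Literature/MeasureTheory/Integral`; namespace `Literature.MeasureTheory.Integral`.  Companion of
`RegionBetweenIntegral.lean` (regions between two graphs).

THE STATEMENT.  Hurley, *Intermediate Calculus* (1980), Sect. 5.5, Theorem 5.2: for the basic polar region
`S = {(r cos θ, r sin θ) | a ≤ r ≤ b, α ≤ θ ≤ β}` and `g(r, θ) = f(r cos θ, r sin θ)`,
`∬_S f dA = ∫_a^b r dr ∫_α^β g(r, θ) dθ` ("`dA = r dr dθ`, NOT `dr dθ`"; the change of variables itself is the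
book's Sect. 6.9).  We prove it for Lebesgue integrals from Mathlib's polar change of variables
`integral_comp_polarCoord_symm : ∫ p in polarCoord.target, p.1 • f (polarCoord.symm p) = ∫ p, f p`, applied to the
zero extension of `f` outside `S`, followed by Fubini on the box `[a, b] × [α, β]`.

WHAT IS PROVED (Lebesgue integrals, `volume` on `ℝ × ℝ`; `polarCoord p = (√(x² + y²), arg (x + iy))`):

* `polarSector r₁ r₂ α β = {p | polarCoord p ∈ Icc r₁ r₂ ×ˢ Icc α β}` — the polar rectangle, stated through
  Mathlib's `polarCoord` (so the slit `θ = π` belongs to it iff `β = π`); `measurableSet_polarSector`;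
  `polarCoord_symm_mem_polarSector` (on `polarCoord.target` membership of `(r cos θ, r sin θ)` is membership of
  `(r, θ)` in the box); `polarSector_eq_disk` (`r₁ = 0`, `[α, β] = [-π, π]`: the closed disk
  `{p | p.1 ^ 2 + p.2 ^ 2 ≤ R ^ 2}` — NOT `Metric.closedBall 0 R`, the norm on `ℝ × ℝ` being the sup norm).
* `setIntegral_polarSector_eq_setIntegral_box` — the change of variables with NO hypothesis on `f`:
  `∫ p in S, f p = ∫ q in (Ioi 0 ∩ Icc r₁ r₂) ×ˢ (Ioo (-π) π ∩ Icc α β), q.1 * f (q.1 cos q.2, q.1 sin q.2)`.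
* `IntegrableOn.polarIntegrand_of_polarSector` — `f` integrable on `S` ⇒ the polar integrand
  `q ↦ q.1 * f (q.1 cos q.2, q.1 sin q.2)` integrable on the box (through the in-tree whole-plane transfer
  `Literature.Analysis.Calculus.integrableOn_polarCoord_target`); `Continuous.integrableOn_polarIntegrand_box`.
* THEOREM 5.2: `setIntegral_polarSector_eq_iterated` — for `0 ≤ r₁ ≤ r₂`, `-π ≤ α ≤ β ≤ π` and `f` integrable
  on `S`, `∫ p in S, f p = ∫ r in r₁..r₂, ∫ θ in α..β, r * f (r * cos θ, r * sin θ)`; the variant with the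
  weakest hypothesis (`…_of_integrableOn_box`: polar integrand integrable on the box), the continuous case
  `…_of_continuous` (no side condition), and the disk `setIntegral_disk_eq_iterated(_of_continuous)`:
  `∫ p in {x² + y² ≤ R²}, f p = ∫ r in 0..R, ∫ θ in -π..π, r f(r cos θ, r sin θ)`.
* THE HALF-ANGLE (`π`-FREE) FORMS for the full angle (annuli `polarSector r₁ r₂ (-π) π` and disks, continuous `f`):
  `integral_polarIntegrand_eq_integral_halfRange` / `…_quarterRange` (the rotation `θ ↦ θ ± π` and the reflection
  `θ ↦ -θ` fold `[-π, π]` onto `[-π/2, π/2]`, resp. `[0, π/2]`, the integrand picking up `f (±x, ±y)`);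
  `integral_polarIntegrand_eq_integral_halfAngle` (`θ = 2 arctan u`:
  `∫ θ in -π..π, r f(r cos θ, r sin θ) = ∫ u in -1..1, 2/(1+u²) · (r f(r c, r s) + r f(-r c, -r s))`,
  `c = (1-u²)/(1+u²)`, `s = 2u/(1+u²)`) and the four-term `…_halfAngle₄` over `u ∈ [0, 1]`;
  `setIntegral_polarSector_fullAngle_eq_iterated_halfAngle(₄)`, `setIntegral_disk_eq_iterated_halfAngle(₄)`:
  `∫ p in {x² + y² ≤ R²}, f p = ∫ r in 0..R, ∫ u in 0..1, 2/(1+u²) · Σ_{±,±} r f(±r c, ±r s)` — a box with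
  RATIONAL endpoints and an integrand rational in `u`, which is what a certificate language without a constant `π`
  (such as `GaussLegendreCertND`) needs for a full disk.

WHY IT IS HERE.  The right-hand sides are integrals over a BOX with constant limits, so the kernel-checked box
cubature certificates (`Literature/Analysis/ValidatedNumerics/GaussLegendreCertND`, `TaylorModelIntegralCert2D*`)
certify integrals over disks, annuli and sectors — which the variable-limit route cannot reach (`√(R² − x²)` limits
violate its endpoint conditions).  In-tree neighbours: `Literature/Analysis/Calculus/PlanarPolarIntegral.lean` (the
WHOLE-PLANE iterated polar integral `∫ f = ∫_{(0,∞)} ∫_{(−π,π)} ρ • f(ρ cos θ, ρ sin θ)` for integrable `f`, whose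
integrability transfer we reuse); volume-only or `ℂ` / `EuclideanSpace`-valued polar computations elsewhere in the
tree (disc and sector volumes, annuli in `ℂ`).  New here: SET integrals over bounded polar rectangles of `ℝ × ℝ` as
INTERVAL integrals over a compact box, with both radial and angular limits, the form a box certificate consumes.  HONEST FRAMING: a textbook identity formalised as glue; every published number
belongs to a client cell's ledger and its rigour lives in the kernel-checked verifier it cites.  Deliberately NOT
here: regions between two polar curves `r = h(θ)` (op. cit. (1) of Sect. 5.5 — combine with the fibred-set Fubini of
`RegionBetweenIntegral3D.lean`), cylindrical / spherical coordinates, improper (unbounded) sectors, the half-angle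
form for a general angular range `[α, β]` (only the full angle is folded here).  Everything is
proved; no named fact, no axiom, no `sorry`.

References: [cite: Hurley1980, Sect. 5.5 Thm. 5.2]; [cite: DavisRabinowitz1984, Sect. 5.6.1 (5.6.1.1)].

AI-produced formalisation (H21 engines group, seat eng-quad-3 gen 65, 2026-08-24).
-/

open _root_.MeasureTheory Set intervalIntegral Real
open scoped Interval

namespace Literature.MeasureTheory.Integral

/-! ### One-dimensional glue: a set squeezed between `Ioo a b` and `Icc a b` carries the interval integral -/

/-- If `Ioo a b ⊆ s ⊆ Icc a b` (`a ≤ b`) then `∫ x in s, g x = ∫ x in a..b, g x` (Lebesgue measure has no atoms).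
[folklore] [cite: Hurley1980, Sect. 5.5 Thm. 5.2] -/
theorem setIntegral_eq_intervalIntegral_of_Ioo_subset_of_subset_Icc {a b : ℝ} (hab : a ≤ b) {s : Set ℝ}
    (h₁ : Ioo a b ⊆ s) (h₂ : s ⊆ Icc a b) (g : ℝ → ℝ) : ∫ x in s, g x = ∫ x in a..b, g x := by
  rw [intervalIntegral.integral_of_le hab]
  refine setIntegral_congr_set (ae_eq_set.2 ⟨?_, ?_⟩)
  · refine measure_mono_null (fun x hx => ?_) (measure_singleton a)
    obtain ⟨hxs, hxn⟩ := hx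
    have hx' := h₂ hxs
    by_contra hxa
    exact hxn ⟨lt_of_le_of_ne hx'.1 (fun h => hxa h.symm), hx'.2⟩
  · refine measure_mono_null (fun x hx => ?_) (measure_singleton b)
    obtain ⟨hxI, hxn⟩ := hx
    by_contra hxb
    exact hxn (h₁ ⟨hxI.1, lt_of_le_of_ne hxI.2 hxb⟩)

/-! ### The polar rectangle -/

/-- The polar rectangle `{a ≤ r ≤ b, α ≤ θ ≤ β}` as a subset of the plane, through Mathlib's `polarCoord`
(`r = √(x² + y²)`, `θ = arg (x + iy) ∈ (-π, π]`). [cite: Hurley1980, Sect. 5.5 Thm. 5.2] -/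
def polarSector (r₁ r₂ α β : ℝ) : Set (ℝ × ℝ) :=
  {p : ℝ × ℝ | polarCoord p ∈ Icc r₁ r₂ ×ˢ Icc α β}

/-- `polarCoord` is measurable (its angular part is not continuous across the slit, but measurable).
[cite: Hurley1980, Sect. 5.5 Thm. 5.2] -/
theorem measurable_polarCoord : Measurable (polarCoord : ℝ × ℝ → ℝ × ℝ) := by
  have h : (polarCoord : ℝ × ℝ → ℝ × ℝ) =
      fun q => (√(q.1 ^ 2 + q.2 ^ 2), Complex.arg (Complex.equivRealProd.symm q)) := by
    funext q; rfl
  rw [h]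
  refine Measurable.prodMk (by fun_prop) (Complex.measurable_arg.comp ?_)
  exact Complex.equivRealProdCLM.symm.continuous.measurable

/-- The polar rectangle is measurable. [cite: Hurley1980, Sect. 5.5 Thm. 5.2] -/
theorem measurableSet_polarSector (r₁ r₂ α β : ℝ) : MeasurableSet (polarSector r₁ r₂ α β) :=
  measurable_polarCoord (measurableSet_Icc.prod measurableSet_Icc)

/-- On `polarCoord.target = (0, ∞) × (-π, π)`: `(r cos θ, r sin θ) ∈ S ↔ (r, θ)` lies in the box.
[cite: Hurley1980, Sect. 5.5 Thm. 5.2] -/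
theorem polarCoord_symm_mem_polarSector {r₁ r₂ α β : ℝ} {q : ℝ × ℝ} (hq : q ∈ polarCoord.target) :
    polarCoord.symm q ∈ polarSector r₁ r₂ α β ↔ q ∈ Icc r₁ r₂ ×ˢ Icc α β := by
  simp only [polarSector, mem_setOf_eq, polarCoord.right_inv hq]

/-- For `0 ≤ R`, the polar rectangle `[0, R] × [-π, π]` is the closed disk `{x² + y² ≤ R²}` (every angle
`arg ∈ (-π, π]` qualifies). [cite: Hurley1980, Sect. 5.5 Thm. 5.2] -/
theorem polarSector_eq_disk {R : ℝ} (hR : 0 ≤ R) :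
    polarSector 0 R (-π) π = {p : ℝ × ℝ | p.1 ^ 2 + p.2 ^ 2 ≤ R ^ 2} := by
  ext p
  simp only [polarSector, mem_setOf_eq, mem_prod, mem_Icc, polarCoord_apply]
  constructor
  · rintro ⟨⟨-, h⟩, -⟩
    calc p.1 ^ 2 + p.2 ^ 2 = (√(p.1 ^ 2 + p.2 ^ 2)) ^ 2 := (Real.sq_sqrt (by positivity)).symm
      _ ≤ R ^ 2 := by gcongr
  · intro h
    refine ⟨⟨Real.sqrt_nonneg _, ?_⟩, (Complex.neg_pi_lt_arg _).le, Complex.arg_le_pi _⟩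
    calc √(p.1 ^ 2 + p.2 ^ 2) ≤ √(R ^ 2) := Real.sqrt_le_sqrt h
      _ = R := Real.sqrt_sq hR

/-! ### The change of variables on the polar rectangle -/

/-- **Polar change of variables on a polar rectangle**, no hypothesis on `f`:
`∫ p in S, f p = ∫ q in (Ioi 0 ∩ Icc r₁ r₂) ×ˢ (Ioo (-π) π ∩ Icc α β), q.1 * f (q.1 cos q.2, q.1 sin q.2)`
(`integral_comp_polarCoord_symm` for the zero extension of `f`; both sides are `0` together when not integrable).
[cite: Hurley1980, Sect. 5.5 Thm. 5.2] -/
theorem setIntegral_polarSector_eq_setIntegral_box (r₁ r₂ α β : ℝ) (f : ℝ × ℝ → ℝ) :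
    ∫ p in polarSector r₁ r₂ α β, f p =
      ∫ q in (Ioi (0 : ℝ) ∩ Icc r₁ r₂) ×ˢ (Ioo (-π) π ∩ Icc α β), q.1 * f (q.1 * cos q.2, q.1 * sin q.2) := by
  set S := polarSector r₁ r₂ α β with hSdef
  have hS : MeasurableSet S := measurableSet_polarSector r₁ r₂ α β
  have hB : MeasurableSet (Icc r₁ r₂ ×ˢ Icc α β) := measurableSet_Icc.prod measurableSet_Icc
  have hT : MeasurableSet polarCoord.target := polarCoord.open_target.measurableSet
  rw [← MeasureTheory.integral_indicator hS, ← integral_comp_polarCoord_symm (S.indicator f)]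
  have h1 : ∫ q in polarCoord.target, q.1 • S.indicator f (polarCoord.symm q) =
      ∫ q in polarCoord.target, (Icc r₁ r₂ ×ˢ Icc α β).indicator
        (fun q : ℝ × ℝ => q.1 * f (q.1 * cos q.2, q.1 * sin q.2)) q := by
    refine setIntegral_congr_fun hT fun q hq => ?_
    by_cases hqB : q ∈ Icc r₁ r₂ ×ˢ Icc α β
    · rw [indicator_of_mem hqB, indicator_of_mem ((polarCoord_symm_mem_polarSector hq).2 hqB), smul_eq_mul,
        polarCoord_symm_apply]
    · rw [indicator_of_notMem hqB,
        indicator_of_notMem (fun h => hqB ((polarCoord_symm_mem_polarSector hq).1 h)), smul_zero]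
  rw [h1, setIntegral_indicator hB, polarCoord_target, Set.prod_inter_prod]

/-! ### Integrability of the polar integrand -/

/-- If `f` is integrable on the polar rectangle then the polar integrand `(r, θ) ↦ r f(r cos θ, r sin θ)` is
integrable on the corresponding box (its part inside `polarCoord.target`, which is all that matters) — from the
in-tree whole-plane transfer `Literature.Analysis.Calculus.integrableOn_polarCoord_target` applied to the zero
extension of `f`. [cite: Hurley1980, Sect. 5.5 Thm. 5.2] -/
theorem _root_.MeasureTheory.IntegrableOn.polarIntegrand_of_polarSector {r₁ r₂ α β : ℝ} {f : ℝ × ℝ → ℝ}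
    (hf : IntegrableOn f (polarSector r₁ r₂ α β)) :
    IntegrableOn (fun q : ℝ × ℝ => q.1 * f (q.1 * cos q.2, q.1 * sin q.2))
      ((Ioi (0 : ℝ) ∩ Icc r₁ r₂) ×ˢ (Ioo (-π) π ∩ Icc α β)) := by
  set S := polarSector r₁ r₂ α β with hSdef
  have hS : MeasurableSet S := measurableSet_polarSector r₁ r₂ α β
  have hB : MeasurableSet (Icc r₁ r₂ ×ˢ Icc α β) := measurableSet_Icc.prod measurableSet_Icc
  have hT : MeasurableSet polarCoord.target := polarCoord.open_target.measurableSet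
  have h1 : IntegrableOn (fun q : ℝ × ℝ => q.1 • S.indicator f (polarCoord.symm q)) polarCoord.target :=
    Literature.Analysis.Calculus.integrableOn_polarCoord_target ((integrable_indicator_iff hS).2 hf)
  have h2 : IntegrableOn (fun q : ℝ × ℝ => q.1 * f (q.1 * cos q.2, q.1 * sin q.2))
      (polarCoord.target ∩ Icc r₁ r₂ ×ˢ Icc α β) := by
    refine (h1.mono_set inter_subset_left).congr_fun (fun q hq => ?_) (hT.inter hB)
    show q.1 • S.indicator f (polarCoord.symm q) = q.1 * f (q.1 * cos q.2, q.1 * sin q.2)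
    rw [indicator_of_mem ((polarCoord_symm_mem_polarSector hq.1).2 hq.2), smul_eq_mul, polarCoord_symm_apply]
  rwa [polarCoord_target, Set.prod_inter_prod] at h2

/-- The polar integrand of a continuous `f` is integrable on the (compact) box.
[cite: Hurley1980, Sect. 5.5 Thm. 5.2] -/
theorem _root_.Continuous.integrableOn_polarIntegrand_box {f : ℝ × ℝ → ℝ} (hf : Continuous f) (r₁ r₂ α β : ℝ) :
    IntegrableOn (fun q : ℝ × ℝ => q.1 * f (q.1 * cos q.2, q.1 * sin q.2)) (Icc r₁ r₂ ×ˢ Icc α β) := by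
  have hc : Continuous fun q : ℝ × ℝ => q.1 * f (q.1 * cos q.2, q.1 * sin q.2) := by fun_prop
  exact hc.continuousOn.integrableOn_compact (isCompact_Icc.prod isCompact_Icc)

/-! ### Theorem 5.2: the iterated form -/

/-- **The iterated form, weakest hypothesis**: for `0 ≤ r₁ ≤ r₂`, `-π ≤ α ≤ β ≤ π` and the polar integrand
integrable on `((0, ∞) ∩ [r₁, r₂]) × ((-π, π) ∩ [α, β])`,
`∫ p in S, f p = ∫ r in r₁..r₂, ∫ θ in α..β, r * f (r cos θ, r sin θ)`. [cite: Hurley1980, Sect. 5.5 Thm. 5.2] -/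
theorem setIntegral_polarSector_eq_iterated_of_integrableOn_box {r₁ r₂ α β : ℝ} (hr₁ : 0 ≤ r₁) (hr : r₁ ≤ r₂)
    (hα : -π ≤ α) (hαβ : α ≤ β) (hβ : β ≤ π) {f : ℝ × ℝ → ℝ}
    (hint : IntegrableOn (fun q : ℝ × ℝ => q.1 * f (q.1 * cos q.2, q.1 * sin q.2))
      ((Ioi (0 : ℝ) ∩ Icc r₁ r₂) ×ˢ (Ioo (-π) π ∩ Icc α β))) :
    ∫ p in polarSector r₁ r₂ α β, f p = ∫ r in r₁..r₂, ∫ θ in α..β, r * f (r * cos θ, r * sin θ) := by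
  rw [setIntegral_polarSector_eq_setIntegral_box, Measure.volume_eq_prod, setIntegral_prod _ hint]
  have inner : ∀ r : ℝ, ∫ θ in Ioo (-π) π ∩ Icc α β, r * f (r * cos θ, r * sin θ) =
      ∫ θ in α..β, r * f (r * cos θ, r * sin θ) := fun r =>
    setIntegral_eq_intervalIntegral_of_Ioo_subset_of_subset_Icc hαβ (s := Ioo (-π) π ∩ Icc α β)
      (fun θ hθ => ⟨⟨lt_of_le_of_lt hα hθ.1, lt_of_lt_of_le hθ.2 hβ⟩, Ioo_subset_Icc_self hθ⟩)
      inter_subset_right _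
  simp only [inner]
  exact setIntegral_eq_intervalIntegral_of_Ioo_subset_of_subset_Icc hr (s := Ioi 0 ∩ Icc r₁ r₂)
    (fun r hrI => ⟨lt_of_le_of_lt hr₁ hrI.1, Ioo_subset_Icc_self hrI⟩) inter_subset_right _

/-- **Hurley's Theorem 5.5.2** (polar double integral by iteration): for `0 ≤ r₁ ≤ r₂`, `-π ≤ α ≤ β ≤ π` and `f`
integrable on the polar rectangle `S`, `∫ p in S, f p = ∫ r in r₁..r₂, ∫ θ in α..β, r * f (r cos θ, r sin θ)` —
`dA = r dr dθ`. [cite: Hurley1980, Sect. 5.5 Thm. 5.2] [cite: DavisRabinowitz1984, Sect. 5.6.1 (5.6.1.1)] -/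
theorem setIntegral_polarSector_eq_iterated {r₁ r₂ α β : ℝ} (hr₁ : 0 ≤ r₁) (hr : r₁ ≤ r₂) (hα : -π ≤ α)
    (hαβ : α ≤ β) (hβ : β ≤ π) {f : ℝ × ℝ → ℝ} (hf : IntegrableOn f (polarSector r₁ r₂ α β)) :
    ∫ p in polarSector r₁ r₂ α β, f p = ∫ r in r₁..r₂, ∫ θ in α..β, r * f (r * cos θ, r * sin θ) :=
  setIntegral_polarSector_eq_iterated_of_integrableOn_box hr₁ hr hα hαβ hβ hf.polarIntegrand_of_polarSector

/-- **Theorem 5.5.2, continuous case**: no side condition. [cite: Hurley1980, Sect. 5.5 Thm. 5.2] -/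
theorem setIntegral_polarSector_eq_iterated_of_continuous {r₁ r₂ α β : ℝ} (hr₁ : 0 ≤ r₁) (hr : r₁ ≤ r₂)
    (hα : -π ≤ α) (hαβ : α ≤ β) (hβ : β ≤ π) {f : ℝ × ℝ → ℝ} (hf : Continuous f) :
    ∫ p in polarSector r₁ r₂ α β, f p = ∫ r in r₁..r₂, ∫ θ in α..β, r * f (r * cos θ, r * sin θ) :=
  setIntegral_polarSector_eq_iterated_of_integrableOn_box hr₁ hr hα hαβ hβ
    ((hf.integrableOn_polarIntegrand_box r₁ r₂ α β).mono_set (prod_mono inter_subset_right inter_subset_right))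

/-- **The disk**: `∫ p in {x² + y² ≤ R²}, f p = ∫ r in 0..R, ∫ θ in -π..π, r * f (r cos θ, r sin θ)` for `0 ≤ R`
and `f` integrable on the disk. [cite: Hurley1980, Sect. 5.5 Thm. 5.2] -/
theorem setIntegral_disk_eq_iterated {R : ℝ} (hR : 0 ≤ R) {f : ℝ × ℝ → ℝ}
    (hf : IntegrableOn f {p : ℝ × ℝ | p.1 ^ 2 + p.2 ^ 2 ≤ R ^ 2}) :
    ∫ p in {p : ℝ × ℝ | p.1 ^ 2 + p.2 ^ 2 ≤ R ^ 2}, f p =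
      ∫ r in (0 : ℝ)..R, ∫ θ in (-π)..π, r * f (r * cos θ, r * sin θ) := by
  rw [← polarSector_eq_disk hR] at hf ⊢
  exact setIntegral_polarSector_eq_iterated le_rfl hR le_rfl (by linarith [pi_pos]) le_rfl hf

/-- **The disk, continuous case**: no side condition. [cite: Hurley1980, Sect. 5.5 Thm. 5.2] -/
theorem setIntegral_disk_eq_iterated_of_continuous {R : ℝ} (hR : 0 ≤ R) {f : ℝ × ℝ → ℝ} (hf : Continuous f) :
    ∫ p in {p : ℝ × ℝ | p.1 ^ 2 + p.2 ^ 2 ≤ R ^ 2}, f p =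
      ∫ r in (0 : ℝ)..R, ∫ θ in (-π)..π, r * f (r * cos θ, r * sin θ) := by
  rw [← polarSector_eq_disk hR]
  exact setIntegral_polarSector_eq_iterated_of_continuous le_rfl hR le_rfl (by linarith [pi_pos]) le_rfl hf

/-! ### The half-angle (Weierstrass) form: rational limits and no `π`

Certificate languages whose boxes have RATIONAL endpoints and whose expressions have no constant `π` (e.g. the
product Gauss–Legendre certificates `GaussLegendreCertND`) cannot take the full angle `θ ∈ [-π, π]` directly.  The
rotation `θ ↦ θ ± π` and the reflection `θ ↦ -θ` fold the full angle onto `[0, π/2]` (the integrand picks up the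
reflected copies `f (±x, ±y)`), and the substitution `θ = 2 arctan u` then rewrites the angular integral as an
integral over `u ∈ [-1, 1]` (two terms) or `u ∈ [0, 1]` (four terms) of an expression RATIONAL in `u`:
`cos θ = (1 - u²)/(1 + u²)`, `sin θ = 2u/(1 + u²)`, `dθ = 2 du/(1 + u²)` (the classical `t = tan(θ/2)`
substitution).  So an annulus or a disk becomes the box `[r₁, r₂] × [0, 1]` with a `π`-free integrand. -/

/-- `cos (2 arctan u) = (1 - u²)/(1 + u²)` (a public copy lives in `Literature.NumberTheory.LFunctions.KatkovaPF44Proofs`,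
not imported here to keep the import closure small). [folklore] -/
private theorem cos_two_mul_arctan (u : ℝ) : cos (2 * arctan u) = (1 - u ^ 2) / (1 + u ^ 2) := by
  have h1 : (0 : ℝ) < 1 + u ^ 2 := by positivity
  rw [cos_two_mul, cos_sq_arctan]
  field_simp
  ring

/-- `sin (2 arctan u) = 2u/(1 + u²)`. [folklore] -/
private theorem sin_two_mul_arctan (u : ℝ) : sin (2 * arctan u) = 2 * u / (1 + u ^ 2) := by
  have h1 : (0 : ℝ) < 1 + u ^ 2 := by positivity
  rw [sin_two_mul, sin_arctan, cos_arctan, mul_assoc, div_mul_div_comm, Real.mul_self_sqrt h1.le]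
  ring

/-- **Folding the full angle onto `[-π/2, π/2]`** (rotation by `π`): for continuous `f`,
`∫ θ in -π..π, r f(r cos θ, r sin θ) = ∫ θ in -π/2..π/2, (r f(r cos θ, r sin θ) + r f(-r cos θ, -r sin θ))`.
[folklore] [cite: Hurley1980, Sect. 5.5 Thm. 5.2] -/
theorem integral_polarIntegrand_eq_integral_halfRange {f : ℝ × ℝ → ℝ} (hf : Continuous f) (r : ℝ) :
    ∫ θ in (-π)..π, r * f (r * cos θ, r * sin θ) =
      ∫ θ in (-(π / 2))..(π / 2), (r * f (r * cos θ, r * sin θ) + r * f (-(r * cos θ), -(r * sin θ))) := by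
  have gc : Continuous fun θ : ℝ => r * f (r * cos θ, r * sin θ) := by fun_prop
  have hc : Continuous fun θ : ℝ => r * f (-(r * cos θ), -(r * sin θ)) := by fun_prop
  have gii : ∀ a b : ℝ, IntervalIntegrable (fun θ : ℝ => r * f (r * cos θ, r * sin θ)) volume a b :=
    fun a b => gc.intervalIntegrable a b
  have hii : ∀ a b : ℝ, IntervalIntegrable (fun θ : ℝ => r * f (-(r * cos θ), -(r * sin θ))) volume a b :=
    fun a b => hc.intervalIntegrable a b
  have split : ∫ θ in (-π)..π, r * f (r * cos θ, r * sin θ) =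
      (∫ θ in (-π)..(-(π / 2)), r * f (r * cos θ, r * sin θ)) +
        ((∫ θ in (-(π / 2))..(π / 2), r * f (r * cos θ, r * sin θ)) +
          ∫ θ in (π / 2)..π, r * f (r * cos θ, r * sin θ)) := by
    rw [integral_add_adjacent_intervals (gii _ _) (gii _ _), integral_add_adjacent_intervals (gii _ _) (gii _ _)]
  have left : ∫ θ in (-π)..(-(π / 2)), r * f (r * cos θ, r * sin θ) =
      ∫ x in (0:ℝ)..(π / 2), r * f (-(r * cos x), -(r * sin x)) := by
    have e := intervalIntegral.integral_comp_sub_right (fun θ : ℝ => r * f (r * cos θ, r * sin θ))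
      (a := 0) (b := π / 2) π
    rw [zero_sub, show π / 2 - π = -(π / 2) by ring] at e
    rw [← e]
    refine intervalIntegral.integral_congr fun x _ => ?_
    simp only [cos_sub_pi, sin_sub_pi, mul_neg]
  have right : ∫ θ in (π / 2)..π, r * f (r * cos θ, r * sin θ) =
      ∫ x in (-(π / 2))..(0:ℝ), r * f (-(r * cos x), -(r * sin x)) := by
    have e := intervalIntegral.integral_comp_add_right (fun θ : ℝ => r * f (r * cos θ, r * sin θ))
      (a := -(π / 2)) (b := 0) π
    rw [zero_add, show -(π / 2) + π = π / 2 by ring] at e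
    rw [← e]
    refine intervalIntegral.integral_congr fun x _ => ?_
    simp only [cos_add_pi, sin_add_pi, mul_neg]
  rw [split, left, right, intervalIntegral.integral_add (gii _ _) (hii _ _),
    ← integral_add_adjacent_intervals (hii (-(π / 2)) 0) (hii 0 (π / 2))]
  ring

/-- **Folding the full angle onto `[0, π/2]`** (rotation by `π` and reflection): for continuous `f`,
`∫ θ in -π..π, r f(r cos θ, r sin θ) = ∫ θ in 0..π/2, Σ_{±,±} r f(±r cos θ, ±r sin θ)`.
[folklore] [cite: Hurley1980, Sect. 5.5 Thm. 5.2] -/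
theorem integral_polarIntegrand_eq_integral_quarterRange {f : ℝ × ℝ → ℝ} (hf : Continuous f) (r : ℝ) :
    ∫ θ in (-π)..π, r * f (r * cos θ, r * sin θ) =
      ∫ θ in (0:ℝ)..(π / 2), (r * f (r * cos θ, r * sin θ) + r * f (-(r * cos θ), -(r * sin θ)) +
        (r * f (r * cos θ, -(r * sin θ)) + r * f (-(r * cos θ), r * sin θ))) := by
  have Gc : Continuous fun θ : ℝ => r * f (r * cos θ, r * sin θ) + r * f (-(r * cos θ), -(r * sin θ)) := by
    fun_prop
  have Gc' : Continuous fun θ : ℝ => r * f (r * cos θ, -(r * sin θ)) + r * f (-(r * cos θ), r * sin θ) := by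
    fun_prop
  have hrefl : ∫ θ in (-(π / 2))..(0:ℝ), (r * f (r * cos θ, r * sin θ) + r * f (-(r * cos θ), -(r * sin θ))) =
      ∫ x in (0:ℝ)..(π / 2), (r * f (r * cos x, -(r * sin x)) + r * f (-(r * cos x), r * sin x)) := by
    have e := intervalIntegral.integral_comp_neg
      (fun θ : ℝ => r * f (r * cos θ, r * sin θ) + r * f (-(r * cos θ), -(r * sin θ))) (a := 0) (b := π / 2)
    rw [neg_zero] at e
    rw [← e]
    refine intervalIntegral.integral_congr fun x _ => ?_
    simp only [cos_neg, sin_neg, mul_neg, neg_neg]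
  rw [integral_polarIntegrand_eq_integral_halfRange hf r,
    ← integral_add_adjacent_intervals (Gc.intervalIntegrable (-(π / 2)) 0) (Gc.intervalIntegrable 0 (π / 2)),
    hrefl, intervalIntegral.integral_add (Gc.intervalIntegrable _ _) (Gc'.intervalIntegrable _ _)]
  ring

/-- **Full-angle polar integrand by the half-angle substitution (two terms, `u ∈ [-1, 1]`)**: for continuous `f`
and any `r`, `∫ θ in -π..π, r f(r cos θ, r sin θ) = ∫ u in -1..1, 2/(1+u²) · (r f(r c, r s) + r f(-r c, -r s))`
with `c = (1 - u²)/(1 + u²)`, `s = 2u/(1 + u²)`. [folklore] [cite: Hurley1980, Sect. 5.5 Thm. 5.2] -/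
theorem integral_polarIntegrand_eq_integral_halfAngle {f : ℝ × ℝ → ℝ} (hf : Continuous f) (r : ℝ) :
    ∫ θ in (-π)..π, r * f (r * cos θ, r * sin θ) =
      ∫ u in (-1:ℝ)..1, 2 / (1 + u ^ 2) *
        (r * f (r * ((1 - u ^ 2) / (1 + u ^ 2)), r * (2 * u / (1 + u ^ 2))) +
          r * f (-(r * ((1 - u ^ 2) / (1 + u ^ 2))), -(r * (2 * u / (1 + u ^ 2))))) := by
  have hderiv : ∀ u ∈ uIcc (-1:ℝ) 1, HasDerivAt (fun u : ℝ => 2 * arctan u) (2 * (1 / (1 + u ^ 2))) u :=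
    fun u _ => (hasDerivAt_arctan u).const_mul 2
  have hφ' : Continuous fun u : ℝ => 2 * (1 / (1 + u ^ 2)) :=
    continuous_const.mul (continuous_const.div (by fun_prop) fun u => by positivity)
  have hGH : Continuous fun θ : ℝ => r * f (r * cos θ, r * sin θ) + r * f (-(r * cos θ), -(r * sin θ)) := by
    fun_prop
  have hsub := intervalIntegral.integral_comp_mul_deriv hderiv hφ'.continuousOn hGH
  rw [arctan_neg, arctan_one, show (2 : ℝ) * -(π / 4) = -(π / 2) by ring,
    show (2 : ℝ) * (π / 4) = π / 2 by ring] at hsub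
  rw [integral_polarIntegrand_eq_integral_halfRange hf r, ← hsub]
  refine intervalIntegral.integral_congr fun u _ => ?_
  simp only [Function.comp_apply, cos_two_mul_arctan, sin_two_mul_arctan]
  ring

/-- **Full-angle polar integrand by the half-angle substitution (four terms, `u ∈ [0, 1]`)**: for continuous `f`
and any `r`, `∫ θ in -π..π, r f(r cos θ, r sin θ) = ∫ u in 0..1, 2/(1+u²) · Σ_{±,±} r f(±r c, ±r s)` with
`c = (1 - u²)/(1 + u²)`, `s = 2u/(1 + u²)` — the smallest box. [folklore] [cite: Hurley1980, Sect. 5.5 Thm. 5.2] -/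
theorem integral_polarIntegrand_eq_integral_halfAngle₄ {f : ℝ × ℝ → ℝ} (hf : Continuous f) (r : ℝ) :
    ∫ θ in (-π)..π, r * f (r * cos θ, r * sin θ) =
      ∫ u in (0:ℝ)..1, 2 / (1 + u ^ 2) *
        (r * f (r * ((1 - u ^ 2) / (1 + u ^ 2)), r * (2 * u / (1 + u ^ 2))) +
            r * f (-(r * ((1 - u ^ 2) / (1 + u ^ 2))), -(r * (2 * u / (1 + u ^ 2)))) +
          (r * f (r * ((1 - u ^ 2) / (1 + u ^ 2)), -(r * (2 * u / (1 + u ^ 2)))) +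
            r * f (-(r * ((1 - u ^ 2) / (1 + u ^ 2))), r * (2 * u / (1 + u ^ 2))))) := by
  have hderiv : ∀ u ∈ uIcc (0:ℝ) 1, HasDerivAt (fun u : ℝ => 2 * arctan u) (2 * (1 / (1 + u ^ 2))) u :=
    fun u _ => (hasDerivAt_arctan u).const_mul 2
  have hφ' : Continuous fun u : ℝ => 2 * (1 / (1 + u ^ 2)) :=
    continuous_const.mul (continuous_const.div (by fun_prop) fun u => by positivity)
  have hG : Continuous fun θ : ℝ => r * f (r * cos θ, r * sin θ) + r * f (-(r * cos θ), -(r * sin θ)) +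
      (r * f (r * cos θ, -(r * sin θ)) + r * f (-(r * cos θ), r * sin θ)) := by
    fun_prop
  have hsub := intervalIntegral.integral_comp_mul_deriv hderiv hφ'.continuousOn hG
  rw [arctan_zero, arctan_one, mul_zero, show (2 : ℝ) * (π / 4) = π / 2 by ring] at hsub
  rw [integral_polarIntegrand_eq_integral_quarterRange hf r, ← hsub]
  refine intervalIntegral.integral_congr fun u _ => ?_
  simp only [Function.comp_apply, cos_two_mul_arctan, sin_two_mul_arctan]
  ring

/-- **The annulus / full sector in half-angle form** (two terms): for `0 ≤ r₁ ≤ r₂` and continuous `f`,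
`∫ p in polarSector r₁ r₂ (-π) π, f p = ∫ r in r₁..r₂, ∫ u in -1..1, 2/(1+u²) · (r f(r c, r s) + r f(-r c, -r s))`,
`c = (1 - u²)/(1 + u²)`, `s = 2u/(1 + u²)` — rational endpoints, `π`-free integrand.
[cite: Hurley1980, Sect. 5.5 Thm. 5.2] -/
theorem setIntegral_polarSector_fullAngle_eq_iterated_halfAngle {r₁ r₂ : ℝ} (hr₁ : 0 ≤ r₁) (hr : r₁ ≤ r₂)
    {f : ℝ × ℝ → ℝ} (hf : Continuous f) :
    ∫ p in polarSector r₁ r₂ (-π) π, f p =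
      ∫ r in r₁..r₂, ∫ u in (-1:ℝ)..1, 2 / (1 + u ^ 2) *
        (r * f (r * ((1 - u ^ 2) / (1 + u ^ 2)), r * (2 * u / (1 + u ^ 2))) +
          r * f (-(r * ((1 - u ^ 2) / (1 + u ^ 2))), -(r * (2 * u / (1 + u ^ 2))))) := by
  rw [setIntegral_polarSector_eq_iterated_of_continuous hr₁ hr le_rfl (by linarith [pi_pos]) le_rfl hf]
  exact intervalIntegral.integral_congr fun r _ => integral_polarIntegrand_eq_integral_halfAngle hf r

/-- **The annulus / full sector in half-angle form** (four terms, the box `[r₁, r₂] × [0, 1]`).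
[cite: Hurley1980, Sect. 5.5 Thm. 5.2] -/
theorem setIntegral_polarSector_fullAngle_eq_iterated_halfAngle₄ {r₁ r₂ : ℝ} (hr₁ : 0 ≤ r₁) (hr : r₁ ≤ r₂)
    {f : ℝ × ℝ → ℝ} (hf : Continuous f) :
    ∫ p in polarSector r₁ r₂ (-π) π, f p =
      ∫ r in r₁..r₂, ∫ u in (0:ℝ)..1, 2 / (1 + u ^ 2) *
        (r * f (r * ((1 - u ^ 2) / (1 + u ^ 2)), r * (2 * u / (1 + u ^ 2))) +
            r * f (-(r * ((1 - u ^ 2) / (1 + u ^ 2))), -(r * (2 * u / (1 + u ^ 2)))) +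
          (r * f (r * ((1 - u ^ 2) / (1 + u ^ 2)), -(r * (2 * u / (1 + u ^ 2)))) +
            r * f (-(r * ((1 - u ^ 2) / (1 + u ^ 2))), r * (2 * u / (1 + u ^ 2))))) := by
  rw [setIntegral_polarSector_eq_iterated_of_continuous hr₁ hr le_rfl (by linarith [pi_pos]) le_rfl hf]
  exact intervalIntegral.integral_congr fun r _ => integral_polarIntegrand_eq_integral_halfAngle₄ hf r

/-- **The disk in half-angle form** (two terms): for `0 ≤ R` and continuous `f`,
`∫ p in {x² + y² ≤ R²}, f p = ∫ r in 0..R, ∫ u in -1..1, 2/(1+u²) · (r f(r c, r s) + r f(-r c, -r s))`.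
[cite: Hurley1980, Sect. 5.5 Thm. 5.2] -/
theorem setIntegral_disk_eq_iterated_halfAngle {R : ℝ} (hR : 0 ≤ R) {f : ℝ × ℝ → ℝ} (hf : Continuous f) :
    ∫ p in {p : ℝ × ℝ | p.1 ^ 2 + p.2 ^ 2 ≤ R ^ 2}, f p =
      ∫ r in (0:ℝ)..R, ∫ u in (-1:ℝ)..1, 2 / (1 + u ^ 2) *
        (r * f (r * ((1 - u ^ 2) / (1 + u ^ 2)), r * (2 * u / (1 + u ^ 2))) +
          r * f (-(r * ((1 - u ^ 2) / (1 + u ^ 2))), -(r * (2 * u / (1 + u ^ 2))))) := by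
  rw [← polarSector_eq_disk hR]
  exact setIntegral_polarSector_fullAngle_eq_iterated_halfAngle le_rfl hR hf

/-- **The disk in half-angle form** (four terms, the box `[0, R] × [0, 1]`): for `0 ≤ R` and continuous `f`,
`∫ p in {x² + y² ≤ R²}, f p = ∫ r in 0..R, ∫ u in 0..1, 2/(1+u²) · Σ_{±,±} r f(±r c, ±r s)`.
[cite: Hurley1980, Sect. 5.5 Thm. 5.2] -/
theorem setIntegral_disk_eq_iterated_halfAngle₄ {R : ℝ} (hR : 0 ≤ R) {f : ℝ × ℝ → ℝ} (hf : Continuous f) :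
    ∫ p in {p : ℝ × ℝ | p.1 ^ 2 + p.2 ^ 2 ≤ R ^ 2}, f p =
      ∫ r in (0:ℝ)..R, ∫ u in (0:ℝ)..1, 2 / (1 + u ^ 2) *
        (r * f (r * ((1 - u ^ 2) / (1 + u ^ 2)), r * (2 * u / (1 + u ^ 2))) +
            r * f (-(r * ((1 - u ^ 2) / (1 + u ^ 2))), -(r * (2 * u / (1 + u ^ 2)))) +
          (r * f (r * ((1 - u ^ 2) / (1 + u ^ 2)), -(r * (2 * u / (1 + u ^ 2)))) +
            r * f (-(r * ((1 - u ^ 2) / (1 + u ^ 2))), r * (2 * u / (1 + u ^ 2))))) := by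
  rw [← polarSector_eq_disk hR]
  exact setIntegral_polarSector_fullAngle_eq_iterated_halfAngle₄ le_rfl hR hf

end Literature.MeasureTheory.Integral
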